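import Summits.RiemannHypothesis.RiemannHypothesis.Theorems.AsymptoticCriticalLine.Negative.BandForms
import Literature.Barriers.RiemannHypothesis.TuranPartialSumsLiouville

/-!
# Truncation destroys the band: the section `ζ₃(s) = 1 + 2^{−s} + 3^{−s}` (negative lemmas, cycle 3)

Refuted strengthening / split witness for the crux `AsymptoticCriticalLine`
(stmt-RiemannHypothesis-2063, route RuelleBand), unconditional, from the tree's `TuranPartialSums`
toolkit (Bohr's equivalence theorem for sections of `ζ` with a completely multiplicative unimodular
twist, Kronecker, Hurwitz: `infinite_zetaPartialSum_zeros_near_twist_zero`): with the Liouville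
twist, `F₃(σ) = 1 − 2^{−σ} − 3^{−σ}` vanishes at some `σ₃ ∈ (1/2, 1)` (`≈ 0.788`), so the 3-term
section `ζ₃` of the Dirichlet series of `ζ` has infinitely many zeros in EVERY window
`|Re s − σ₃| < r` — an interior band — and NO zero to the right of `σ₃`
(`|ζ₃(s)| ≥ F₃(Re s) > 0` there): `zetaPartialSum_three_interior_band`. Hence the band shape fails
for `ζ₃` (`not_band_zetaPartialSum_three`), through the INTERIOR half of the crux only, its edge
half being true — an unconditional separation of the two halves of card interior-edge-split
(`Split.lean`). Lesson: the band is a property of the complete series / infinite Euler product;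
no truncation (approximate-functional-equation pieces, Dirichlet-polynomial models, finitely many
periodic orbits in a trace formula) has it.
-/

noncomputable section

namespace Summit.RiemannHypothesis.RiemannHypothesis.Theorems.AsymptoticCriticalLine.Negative

open Complex Set
open ArithmeticFunction (liouville)
open Literature.Barriers.RiemannHypothesis (zetaPartialSum realTwistedSum twistedPartialSum
  twistedPartialSum_ofReal continuous_realTwistedSum liouville_real_mul abs_liouville_real_prime
  realTwist_complex_mul realTwist_complex_norm infinite_zetaPartialSum_zeros_near_twist_zero)

/-! ## Truncation: the section `ζ₃(s) = 1 + 2^{−s} + 3^{−s}` -/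

/-- [folklore] -/
theorem Icc_one_three : Finset.Icc 1 3 = {1, 2, 3} := by decide

/-- `ζ₃(s) = 1 + 2^{−s} + 3^{−s}`. [folklore] -/
theorem zetaPartialSum_three (s : ℂ) :
    zetaPartialSum 3 s = 1 + (2 : ℂ) ^ (-s) + (3 : ℂ) ^ (-s) := by
  rw [zetaPartialSum, Icc_one_three, Finset.sum_insert (by decide), Finset.sum_insert (by decide),
    Finset.sum_singleton]
  push_cast
  rw [one_cpow]
  ring

/-- The Liouville-twisted section `F₃(σ) = 1 − 2^{−σ} − 3^{−σ}`. [folklore] -/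
theorem realTwistedSum_liouville_three (σ : ℝ) :
    realTwistedSum (fun n => (liouville n : ℝ)) 3 σ = 1 - (2 : ℝ) ^ (-σ) - (3 : ℝ) ^ (-σ) := by
  rw [realTwistedSum, Icc_one_three, Finset.sum_insert (by decide), Finset.sum_insert (by decide),
    Finset.sum_singleton]
  have h1 : liouville 1 = 1 := by
    rw [ArithmeticFunction.liouville_apply one_ne_zero, ArithmeticFunction.cardFactors_one, pow_zero]
  have h2 : liouville 2 = -1 := by
    rw [ArithmeticFunction.liouville_apply two_ne_zero,
      ArithmeticFunction.cardFactors_apply_prime Nat.prime_two, pow_one]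
  have h3 : liouville 3 = -1 := by
    rw [ArithmeticFunction.liouville_apply (by norm_num),
      ArithmeticFunction.cardFactors_apply_prime Nat.prime_three, pow_one]
  rw [h1, h2, h3]
  push_cast
  rw [Real.one_rpow]
  ring

/-- `F₃(1) = 1/6 > 0`. [folklore] -/
theorem realTwistedSum_liouville_three_one :
    realTwistedSum (fun n => (liouville n : ℝ)) 3 1 = 1 / 6 := by
  rw [realTwistedSum_liouville_three, Real.rpow_neg (by norm_num), Real.rpow_neg (by norm_num),
    Real.rpow_one, Real.rpow_one]
  norm_num

/-- `F₃(1/2) < 0` (`2^{−1/2} > 7/10`, `3^{−1/2} > 1/2`). [folklore] -/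
theorem realTwistedSum_liouville_three_half_neg :
    realTwistedSum (fun n => (liouville n : ℝ)) 3 (1 / 2) < 0 := by
  rw [realTwistedSum_liouville_three]
  have h2 : (7 : ℝ) / 10 < (2 : ℝ) ^ (-(1 / 2 : ℝ)) := by
    rw [Real.rpow_neg (by norm_num), ← Real.sqrt_eq_rpow, lt_inv_comm₀ (by norm_num) (by positivity),
      Real.sqrt_lt' (by norm_num)]
    norm_num
  have h3 : (1 : ℝ) / 2 < (3 : ℝ) ^ (-(1 / 2 : ℝ)) := by
    rw [Real.rpow_neg (by norm_num), ← Real.sqrt_eq_rpow, lt_inv_comm₀ (by norm_num) (by positivity),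
      Real.sqrt_lt' (by norm_num)]
    norm_num
  linarith

/-- `F₃` is strictly increasing. [folklore] -/
theorem realTwistedSum_liouville_three_strictMono :
    StrictMono (realTwistedSum (fun n => (liouville n : ℝ)) 3) := by
  intro a b hab
  rw [realTwistedSum_liouville_three, realTwistedSum_liouville_three]
  have h2 : (2 : ℝ) ^ (-b) < (2 : ℝ) ^ (-a) := Real.rpow_lt_rpow_of_exponent_lt (by norm_num) (by linarith)
  have h3 : (3 : ℝ) ^ (-b) < (3 : ℝ) ^ (-a) := Real.rpow_lt_rpow_of_exponent_lt (by norm_num) (by linarith)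
  linarith

/-- The root `σ₃ ∈ (1/2, 1)` of `2^{−σ} + 3^{−σ} = 1` (numerically `σ₃ ≈ 0.788`). [folklore] -/
theorem exists_root_three :
    ∃ σ₃ : ℝ, 1 / 2 < σ₃ ∧ σ₃ < 1 ∧ realTwistedSum (fun n => (liouville n : ℝ)) 3 σ₃ = 0 := by
  have hivt := intermediate_value_Icc (show (1 / 2 : ℝ) ≤ 1 by norm_num)
    (continuous_realTwistedSum (fun n => (liouville n : ℝ)) 3).continuousOn
  obtain ⟨σ₃, ⟨hlo, hhi⟩, hzero⟩ :=
    hivt ⟨realTwistedSum_liouville_three_half_neg.le, by rw [realTwistedSum_liouville_three_one]; norm_num⟩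
  refine ⟨σ₃, ?_, ?_, hzero⟩
  · rcases hlo.eq_or_lt with h | h
    · exfalso
      have := realTwistedSum_liouville_three_half_neg
      rw [h, hzero] at this
      exact lt_irrefl _ this
    · exact h
  · rcases hhi.eq_or_lt with h | h
    · exfalso
      have h1 := realTwistedSum_liouville_three_one
      rw [h] at hzero
      rw [hzero] at h1
      norm_num at h1
    · exact h

/-- No zeros of `ζ₃` to the right of `σ₃`: `|ζ₃(s)| ≥ 1 − 2^{−σ} − 3^{−σ} = F₃(σ) > F₃(σ₃) = 0`.
[folklore] -/
theorem zetaPartialSum_three_ne_zero {σ₃ : ℝ}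
    (h0 : realTwistedSum (fun n => (liouville n : ℝ)) 3 σ₃ = 0) {s : ℂ} (hs : σ₃ < s.re) :
    zetaPartialSum 3 s ≠ 0 := by
  intro hz
  rw [zetaPartialSum_three] at hz
  have hF : 0 < 1 - (2 : ℝ) ^ (-s.re) - (3 : ℝ) ^ (-s.re) := by
    rw [← realTwistedSum_liouville_three, ← h0]
    exact realTwistedSum_liouville_three_strictMono hs
  have hn2 : ‖(2 : ℂ) ^ (-s)‖ = (2 : ℝ) ^ (-s.re) := by
    rw [show (2 : ℂ) = ((2 : ℕ) : ℂ) by norm_num, Complex.norm_natCast_cpow_of_pos two_pos, neg_re]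
    norm_num
  have hn3 : ‖(3 : ℂ) ^ (-s)‖ = (3 : ℝ) ^ (-s.re) := by
    rw [show (3 : ℂ) = ((3 : ℕ) : ℂ) by norm_num, Complex.norm_natCast_cpow_of_pos (by norm_num), neg_re]
    norm_num
  have htri : ‖(1 : ℂ)‖ - ‖(2 : ℂ) ^ (-s)‖ - ‖(3 : ℂ) ^ (-s)‖ ≤ ‖1 + (2 : ℂ) ^ (-s) + (3 : ℂ) ^ (-s)‖ := by
    have h1 := norm_sub_le (1 + (2 : ℂ) ^ (-s) + (3 : ℂ) ^ (-s)) ((2 : ℂ) ^ (-s) + (3 : ℂ) ^ (-s))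
    rw [show (1 : ℂ) + (2 : ℂ) ^ (-s) + (3 : ℂ) ^ (-s) - ((2 : ℂ) ^ (-s) + (3 : ℂ) ^ (-s)) = 1 by ring] at h1
    have h2 := norm_add_le ((2 : ℂ) ^ (-s)) ((3 : ℂ) ^ (-s))
    linarith
  rw [hz, norm_zero, norm_one, hn2, hn3] at htri
  linarith

/-- TRUNCATION DESTROYS THE BAND. The 3-term section `ζ₃(s) = 1 + 2^{−s} + 3^{−s}` of the
Dirichlet series of `ζ` has an INTERIOR BAND: there is `σ₃ ∈ (1/2, 1)` (the root of
`2^{−σ} + 3^{−σ} = 1`, `≈ 0.788`) such that every window `|Re s − σ₃| < r` contains infinitely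
many zeros of `ζ₃` (Bohr's equivalence theorem with the Liouville twist — `F₃(σ₃) = 0` — then
Kronecker and Hurwitz, all theorems of the tree: `infinite_zetaPartialSum_zeros_near_twist_zero`),
while NO zero lies to the right of `σ₃` (`zetaPartialSum_three_ne_zero`). So `ζ₃` is an
UNCONDITIONAL object with the interior half of the crux FALSE and the edge half TRUE; and the band
shape is a property of the complete series / infinite Euler product, never of a truncation
(approximate-functional-equation pieces, mollifier-type Dirichlet polynomials: barrier
`TuranPartialSums`). [folklore] -/
theorem zetaPartialSum_three_interior_band :
    ∃ σ₃ : ℝ, 1 / 2 < σ₃ ∧ σ₃ < 1 ∧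
      (∀ r : ℝ, 0 < r → {s : ℂ | zetaPartialSum 3 s = 0 ∧ |s.re - σ₃| < r}.Infinite) ∧
      ∀ s : ℂ, zetaPartialSum 3 s = 0 → s.re ≤ σ₃ := by
  obtain ⟨σ₃, hlo, hhi, h0⟩ := exists_root_three
  refine ⟨σ₃, hlo, hhi, fun r hr => ?_, fun s hz => ?_⟩
  · have h0' : twistedPartialSum (fun n => ((liouville n : ℝ) : ℂ)) 3 (σ₃ : ℂ) = 0 := by
      rw [twistedPartialSum_ofReal, h0, ofReal_zero]
    have := infinite_zetaPartialSum_zeros_near_twist_zero (ψ := fun n => ((liouville n : ℝ) : ℂ))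
      (realTwist_complex_mul (χ := fun n => (liouville n : ℝ)) liouville_real_mul)
      (realTwist_complex_norm (χ := fun n => (liouville n : ℝ)) abs_liouville_real_prime)
      (by norm_num) h0' hr
    simpa only [ofReal_re] using this
  · by_contra hlt
    exact zetaPartialSum_three_ne_zero h0 (not_le.1 hlt) hz

/-- Hence the band shape fails for `ζ₃` (its level-`(σ₃ − 1/2)/2` band is infinite). [folklore] -/
theorem not_band_zetaPartialSum_three : ¬ ∀ ε : ℝ, 0 < ε → (bandSet (zetaPartialSum 3) ε).Finite := by
  intro h
  obtain ⟨σ₃, hlo, hhi, hwin, hright⟩ := zetaPartialSum_three_interior_band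
  set r : ℝ := min (σ₃ - 1 / 2) (1 - σ₃) / 2 with hr
  have hr0 : 0 < r := by
    have : 0 < min (σ₃ - 1 / 2) (1 - σ₃) := lt_min (by linarith) (by linarith)
    linarith
  have hr1 : r ≤ (σ₃ - 1 / 2) / 2 := by
    have := min_le_left (σ₃ - 1 / 2) (1 - σ₃); linarith
  have hr2 : r ≤ (1 - σ₃) / 2 := by
    have := min_le_right (σ₃ - 1 / 2) (1 - σ₃); linarith
  refine hwin r hr0 ((h r hr0).subset ?_)
  rintro s ⟨hz, hw⟩
  obtain ⟨hw1, hw2⟩ := abs_sub_lt_iff.1 hw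
  refine ⟨hz, by linarith, by linarith, ?_⟩
  rw [abs_of_pos (by linarith)]
  linarith

end Summit.RiemannHypothesis.RiemannHypothesis.Theorems.AsymptoticCriticalLine.Negative
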